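import Summits.MatrixMultiplication.MatrixMultiplication.Theorems.OutsiderSandwichCoherentSharing
import HarnessLib

/-!
# The refined capacity law: `dim E ≤ 3^j · 4^(N-j)` for `2^j` scalar patterns

Route `OutsiderSandwich` (decomposition cell `decomp-mm`, lens 4 «minimal counterexample /
extremal reduction», gen 28, kernel 1), support for the aside leaf `BlockOneIsMM`
(stmt-MatrixMultiplication-27147, `θ⋆ = 0`); cut of record untouched; theorem-only.

## Content

`OutsiderSandwichTwistCapacity.card_mul_finrank_le` priced a set `C` of patterns acting by scalars
on a subspace `E` of `2^N × 2^N` matrices by `|C| · dim E ≤ 6^N` (Burnside over the scalar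
subgroup `U ⊇ C`, then `Σ_{c ∈ U} #Fix τ_c ≤ Σ_{all c} = 6^N`).  The last step throws away the
structure of `U`; it is sharp only for `U = (ℤ/2)^N`.  This file keeps it:

* `exists_infoSet` — every subgroup `U ≤ (ℤ/2)^N` has an INFORMATION SET `I`: the coordinates of
  `I` are read injectively on `U` and every `0/1` assignment on `I` is attained (a minimal
  injective coordinate set is automatically surjective: a missing unit vector `e_i` lets one drop
  `i`).  Hence `|C| ≤ |U| = 2^{|I|}` (`card_le_two_pow_of_infoSet`).
* `card_normalForm`, `normalForm_covers` — the index pairs `(r, s)` with NO position `i ∈ I`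
  showing `(r_i, s_i) = (1, 0)` number `3^{|I|} · 4^{N-|I|}` and meet every `U`-orbit (twist the
  offending positions away using the element of `U` prescribed on `I`).
* `exists_rank_profile` — **refined capacity law**: if the patterns of `C` act on `E` by scalars,
  then for some `j ≤ N`: `|C| ≤ 2^j` and `dim E ≤ 3^j · 4^{N-j}`; relative form
  `exists_rank_profile_of_relative` (pairwise `τ_{c+c'}` scalar, the COHERENT copies of
  `OutsiderSandwichCoherentSharing`) and the `x`-leg form `exists_rank_profile_range_of_relative`.

For `j = N` this is the old law (`2^N · 3^N = 6^N`); for `j < N` it is strictly stronger: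
`|C| · dim E ≤ 6^j · 4^{N-j} < 6^N`.  A coherent copy wiring `k` blocks has `k ≤ 2^j` and rank
`≤ 3^j 4^{N-j} = 4^N (3/4)^j`, i.e. rank `≤ 4^N · k^{-log₂(4/3)}`: every doubling of the number of
productively used orientations costs a factor `3/4` of the `x`-leg — the exchange is GEOMETRIC in
`k`, not the linear `rank ≤ 6^N / k`.  The companion `OutsiderSandwichCoherentProfile` turns this
into the coherent rate bound `log₂(4/3) / (1 + log₂(4/3)) = 0.2933…` (was `0.2075…`).

## References

* J.-P. Serre, *Linear Representations of Finite Groups*, GTM 42 (1977), §2.3 (orbit counting).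
  [Serre1977]
* F. J. MacWilliams, N. J. A. Sloane, *The Theory of Error-Correcting Codes* (1977), Ch. 1 §1
  (information sets of a linear code). [MacWilliamsSloane1977]
* M. Bläser, *Fast Matrix Multiplication*, Theory of Computing Graduate Surveys 5 (2013), §5.
  [Blaser2013]
-/

noncomputable section

open scoped BigOperators Matrix

set_option linter.dupNamespace false
set_option autoImplicit false

namespace Summit.MatrixMultiplication.MatrixMultiplication.Theorems.OutsiderSandwichRefinedCapacity

open Summit.MatrixMultiplication.MatrixMultiplication.Theorems.OutsiderSandwichTwistGluing
  Summit.MatrixMultiplication.MatrixMultiplication.Theorems.OutsiderSandwichTwistCapacity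

universe u

variable {N : ℕ}

/-! ## 1. Information sets of a subgroup of `(ℤ/2)^N` -/

/-- In `Fin 2`, distinct elements differ by `1`. -/
private theorem sub_eq_one_of_ne (a b : Fin 2) (h : a ≠ b) : a - b = 1 := by
  revert a b; decide

/-- **Information sets exist.**  For a subgroup `U` of patterns there is a coordinate set `I` on
which `U` is read injectively and attains every `0/1` assignment. -/
theorem exists_infoSet (U : AddSubgroup (Idx N)) :
    ∃ I : Finset (Fin N),
      (∀ u ∈ U, ∀ u' ∈ U, (∀ i ∈ I, u i = u' i) → u = u') ∧
      (∀ D : Finset (Fin N), D ⊆ I → ∃ u ∈ U, ∀ i ∈ I, u i = if i ∈ D then 1 else 0) := by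
  classical
  let P : Finset (Fin N) → Prop := fun I => ∀ u ∈ U, ∀ u' ∈ U, (∀ i ∈ I, u i = u' i) → u = u'
  have hne : (Finset.univ.powerset.filter P).Nonempty :=
    ⟨Finset.univ, Finset.mem_filter.2 ⟨Finset.mem_powerset.2 subset_rfl,
      fun u _ u' _ h => funext fun i => h i (Finset.mem_univ i)⟩⟩
  obtain ⟨I, hI, hmin⟩ := Finset.exists_min_image _ Finset.card hne
  have hPI : P I := (Finset.mem_filter.1 hI).2
  refine ⟨I, hPI, ?_⟩
  -- every unit vector on `I` is attained, or `I` was not minimal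
  have hunit : ∀ i ∈ I, ∃ u ∈ U, ∀ i' ∈ I, u i' = if i' = i then 1 else 0 := by
    intro i hi
    by_contra hno
    have hP : P (I.erase i) := by
      intro u hu u' hu' hagree
      by_cases hdi : u i = u' i
      · exact hPI u hu u' hu' fun i' hi' =>
          if h : i' = i then h ▸ hdi else hagree i' (Finset.mem_erase.2 ⟨h, hi'⟩)
      · exfalso
        refine hno ⟨u - u', U.sub_mem hu hu', fun i' hi'I => ?_⟩
        by_cases h : i' = i
        · subst h
          rw [if_pos rfl, Pi.sub_apply]
          exact sub_eq_one_of_ne _ _ hdi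
        · rw [if_neg h, Pi.sub_apply, hagree i' (Finset.mem_erase.2 ⟨h, hi'I⟩), sub_self]
    have hle := hmin (I.erase i)
      (Finset.mem_filter.2 ⟨Finset.mem_powerset.2 (Finset.subset_univ _), hP⟩)
    rw [Finset.card_erase_of_mem hi] at hle
    have hpos : 0 < I.card := Finset.card_pos.2 ⟨i, hi⟩
    omega
  choose! u hu using hunit
  intro D hD
  refine ⟨∑ i ∈ D, u i, sum_mem fun i hi => (hu i (hD hi)).1, fun i' hi' => ?_⟩
  rw [Finset.sum_apply, Finset.sum_congr rfl fun i hi => (hu i (hD hi)).2 i' hi',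
    Finset.sum_ite_eq]

/-- A set of patterns inside a subgroup read injectively on `I` has at most `2^{|I|}` elements. -/
theorem card_le_two_pow_of_infoSet (U : AddSubgroup (Idx N)) (I : Finset (Fin N))
    (hinj : ∀ u ∈ U, ∀ u' ∈ U, (∀ i ∈ I, u i = u' i) → u = u')
    (C : Finset (Idx N)) (hC : ∀ c ∈ C, c ∈ U) : C.card ≤ 2 ^ I.card := by
  classical
  have h := Finset.card_le_card_of_injOn (fun c : Idx N => fun i : I => c i)
    (fun c _ => Finset.mem_coe.2 (Finset.mem_univ _))
    (fun c hc c' hc' h => hinj c (hC c hc) c' (hC c' hc') fun i hi => congrFun h ⟨i, hi⟩)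
  rwa [Finset.card_univ, Fintype.card_fun, Fintype.card_coe, Fintype.card_fin] at h

/-! ## 2. The normal form of an index pair along an information set -/

/-- Bit pairs other than `(1, 0)`: three of four. -/
private theorem card_pair_ne : Fintype.card {t : Fin 2 × Fin 2 // ¬ (t.1 = 1 ∧ t.2 = 0)} = 3 := by
  rfl

/-- **`#(normal forms) = 3^{|I|} · 4^{N-|I|}`**: index pairs with no position of `I` showing
`(1, 0)`. -/
theorem card_normalForm (I : Finset (Fin N)) :
    (Finset.univ.filter fun p : Idx N × Idx N => ∀ i ∈ I, ¬ (p.1 i = 1 ∧ p.2 i = 0)).card =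
      3 ^ I.card * 4 ^ (N - I.card) := by
  classical
  have e : {p : Idx N × Idx N // ∀ i ∈ I, ¬ (p.1 i = 1 ∧ p.2 i = 0)} ≃
      (∀ i : Fin N, {t : Fin 2 × Fin 2 // i ∈ I → ¬ (t.1 = 1 ∧ t.2 = 0)}) :=
    { toFun := fun p i => ⟨(p.1.1 i, p.1.2 i), fun hi => p.2 i hi⟩
      invFun := fun g => ⟨(fun i => (g i).1.1, fun i => (g i).1.2), fun i hi => (g i).2 hi⟩
      left_inv := fun p => rfl
      right_inv := fun g => rfl }
  have hcoord : ∀ i : Fin N,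
      Fintype.card {t : Fin 2 × Fin 2 // i ∈ I → ¬ (t.1 = 1 ∧ t.2 = 0)} =
        if i ∈ I then 3 else 4 := by
    intro i
    by_cases hi : i ∈ I
    · rw [if_pos hi, ← card_pair_ne]
      exact Fintype.card_congr (Equiv.subtypeEquivRight fun t => by simp only [hi, true_implies])
    · rw [if_neg hi]
      calc Fintype.card {t : Fin 2 × Fin 2 // i ∈ I → ¬ (t.1 = 1 ∧ t.2 = 0)}
          = Fintype.card (Fin 2 × Fin 2) :=
            Fintype.card_congr (Equiv.subtypeUnivEquiv fun t => fun h => absurd h hi)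
        _ = 4 := by rw [Fintype.card_prod, Fintype.card_fin]
  have hcompl : (Finset.univ.filter fun i : Fin N => ¬ i ∈ I) = Iᶜ := by
    ext i; simp
  rw [← Fintype.card_subtype, Fintype.card_congr e, Fintype.card_pi,
    Finset.prod_congr rfl fun i _ => hcoord i, Finset.prod_ite, Finset.prod_const,
    Finset.prod_const, Finset.filter_mem_eq_inter, Finset.univ_inter, hcompl, Finset.card_compl,
    Fintype.card_fin]

/-- **Normal forms meet every orbit.**  If `U` attains every `0/1` assignment on `I`, every index
pair is the `U`-twist of a pair in normal form along `I`. -/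
theorem normalForm_covers (U : AddSubgroup (Idx N)) (I : Finset (Fin N))
    (hsurj : ∀ D : Finset (Fin N), D ⊆ I → ∃ u ∈ U, ∀ i ∈ I, u i = if i ∈ D then 1 else 0)
    (p : Idx N × Idx N) :
    ∃ t ∈ (Finset.univ.filter fun q : Idx N × Idx N => ∀ i ∈ I, ¬ (q.1 i = 1 ∧ q.2 i = 0)),
      ∃ u ∈ U, twist u t.1 t.2 = p := by
  classical
  obtain ⟨r, s⟩ := p
  obtain ⟨u, huU, hu⟩ := hsurj (I.filter fun i => r i = 1 ∧ s i = 0) (Finset.filter_subset _ _)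
  refine ⟨twist u r s, Finset.mem_filter.2 ⟨Finset.mem_univ _, fun i hi => ?_⟩, u, huU,
    twist_twist u r s⟩
  have hui := hu i hi
  by_cases hD : r i = 1 ∧ s i = 0
  · rw [if_pos (Finset.mem_filter.2 ⟨hi, hD⟩)] at hui
    simp only [twist_fst, twist_snd, hui, if_true, hD.2]
    exact fun h => absurd h.1 (by decide)
  · rw [if_neg (show i ∉ I.filter (fun i => r i = 1 ∧ s i = 0) from
      fun h => hD (Finset.mem_filter.1 h).2)] at hui
    simp only [twist_fst, twist_snd, hui, zero_ne_one, if_false]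
    exact hD

/-! ## 3. The refined capacity law -/

section Field

variable {K : Type u} [Field K]

/-- In `Fin 2`, `-a = a`. -/
private theorem neg_coord (a : Fin 2) : -a = a := by
  revert a; decide

/-- **Refined capacity law.**  If every pattern of `C` acts on the subspace `E` of `2^N × 2^N`
matrices by a scalar, then for some `j ≤ N`: `|C| ≤ 2^j` and `dim E ≤ 3^j · 4^{N-j}`
(`j` = the size of an information set of the scalar subgroup; `j = N` is
`OutsiderSandwichTwistCapacity.card_mul_finrank_le`). -/
theorem exists_rank_profile (E : Submodule K (Matrix (Idx N) (Idx N) K)) (C : Finset (Idx N))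
    (hC : ∀ c ∈ C, ∃ ε : K, ∀ Y ∈ E, ptrans c Y = ε • Y) :
    ∃ j ≤ N, C.card ≤ 2 ^ j ∧ Module.finrank K E ≤ 3 ^ j * 4 ^ (N - j) := by
  classical
  -- the scalar patterns of `E` form a subgroup of `(ℤ/2)^N`
  let U : AddSubgroup (Idx N) :=
    { carrier := {c | ∃ ε : K, ∀ Y ∈ E, ptrans c Y = ε • Y}
      zero_mem' := ⟨1, fun Y _ => by rw [ptrans_zero, one_smul]⟩
      add_mem' := by
        rintro a b ⟨ε, hε⟩ ⟨ε', hε'⟩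
        refine ⟨ε * ε', fun Y hY => ?_⟩
        rw [← ptrans_comp, hε Y hY, ptrans_smul, hε' Y hY, smul_smul]
      neg_mem' := by
        intro a ha
        have h : -a = a := funext fun i => by rw [Pi.neg_apply, neg_coord]
        rw [h]; exact ha }
  obtain ⟨I, hinj, hsurj⟩ := exists_infoSet U
  refine ⟨I.card, ?_, card_le_two_pow_of_infoSet U I hinj C fun c hc => show c ∈ U from hC c hc,
    ?_⟩
  · calc I.card ≤ (Finset.univ : Finset (Fin N)).card := Finset.card_le_card (Finset.subset_univ _)
      _ = N := by rw [Finset.card_univ, Fintype.card_fin]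
  · rw [← card_normalForm I]
    refine finrank_le_card_of_vanishing E _ fun Y hY h0 => ?_
    ext r s
    obtain ⟨t, ht, c, ⟨ε, hε⟩, htw⟩ := normalForm_covers U I hsurj (r, s)
    have h := congrFun (congrFun (hε Y hY) t.1) t.2
    rw [ptrans_apply, htw, Matrix.smul_apply, h0 t ht, smul_zero] at h
    exact h

/-- **Refined capacity law, relative form** (coherent copies): if `τ_{c+c'}` is a scalar on `E`
for all `c, c' ∈ C`, then for some `j ≤ N`: `|C| ≤ 2^j` and `dim E ≤ 3^j · 4^{N-j}`. -/
theorem exists_rank_profile_of_relative (E : Submodule K (Matrix (Idx N) (Idx N) K))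
    (C : Finset (Idx N))
    (hC : ∀ c ∈ C, ∀ c' ∈ C, ∃ ε : K, ∀ Y ∈ E, ptrans (c + c') Y = ε • Y) :
    ∃ j ≤ N, C.card ≤ 2 ^ j ∧ Module.finrank K E ≤ 3 ^ j * 4 ^ (N - j) := by
  classical
  rcases C.eq_empty_or_nonempty with hCe | ⟨c₀, hc₀⟩
  · refine ⟨0, Nat.zero_le _, ?_, ?_⟩
    · rw [hCe, Finset.card_empty]; exact Nat.zero_le _
    rw [Nat.sub_zero, pow_zero, one_mul]
    refine (Submodule.finrank_le E).trans ?_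
    rw [OutsiderSandwichColumnDisjoint.finrank_matrix_Idx]
  have hinj : Function.Injective (fun c : Idx N => c + c₀) := add_left_injective c₀
  rw [← Finset.card_image_of_injective C hinj]
  refine exists_rank_profile E _ fun d hd => ?_
  obtain ⟨c, hc, rfl⟩ := Finset.mem_image.1 hd
  exact hC c hc c₀ hc₀

/-- The same for the range of an `x`-leg map `A` (`τ_{c+c'} (A X) = ε • A X` for all wired `c, c'`):
`|C| ≤ 2^j` and `rank A ≤ 3^j · 4^{N-j}` for some `j ≤ N`. -/
theorem exists_rank_profile_range_of_relative
    (A : Matrix (Idx N) (Idx N) K →ₗ[K] Matrix (Idx N) (Idx N) K) (C : Finset (Idx N))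
    (hC : ∀ c ∈ C, ∀ c' ∈ C, ∃ ε : K, ∀ X, ptrans (c + c') (A X) = ε • A X) :
    ∃ j ≤ N, C.card ≤ 2 ^ j ∧ Module.finrank K (LinearMap.range A) ≤ 3 ^ j * 4 ^ (N - j) :=
  exists_rank_profile_of_relative _ C fun c hc c' hc' => by
    obtain ⟨ε, hε⟩ := hC c hc c' hc'
    refine ⟨ε, fun Y hY => ?_⟩
    obtain ⟨X, rfl⟩ := LinearMap.mem_range.1 hY
    exact hε X

/-- **The refinement is strict below full untwisting**: `6^j · 4^{N-j} < 6^N` for `j < N`, and it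
reproduces the old law at `j = N`. -/
theorem refined_le_capacity {j : ℕ} (hj : j ≤ N) :
    2 ^ j * (3 ^ j * 4 ^ (N - j)) ≤ 6 ^ N ∧ (j < N → 2 ^ j * (3 ^ j * 4 ^ (N - j)) < 6 ^ N) := by
  obtain ⟨m, rfl⟩ := Nat.exists_eq_add_of_le hj
  rw [Nat.add_sub_cancel_left, ← mul_assoc, ← mul_pow, pow_add,
    show (2 : ℕ) * 3 = 6 by norm_num]
  refine ⟨Nat.mul_le_mul_left _ (Nat.pow_le_pow_left (by norm_num) m), fun hlt => ?_⟩
  exact (Nat.mul_lt_mul_left (pow_pos (by norm_num) j)).2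
    (Nat.pow_lt_pow_left (by norm_num) (by omega))

end Field

end Summit.MatrixMultiplication.MatrixMultiplication.Theorems.OutsiderSandwichRefinedCapacity
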